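import Summits.Langlands.Langlands.Theses.SplitPrimeExitCarving

/-!
# Route SplitPrimeExitCarving — Assembly

The assembly item (stmt-Langlands-27474) of the child route `SplitPrimeExitCarving` (decomp-langlands lens-6 gen 22; a gate-native D-0170
refining child: `--refines route-Langlands-SkinnerWilesDefectOne:ProModularOrdinaryClassical`, edge split, depth 1, no FRAME item) for the
EXIT crux of the LIVE route `SkinnerWilesDefectOne` (stmt-Langlands-12921, the D-0179 blocker):
`SplitPrimeExit → RamifiedPrimeExit → InertPrimeExit → SkinnerWilesDefectOne.ProModularOrdinaryClassical`.

This is literally the type of the route file's sorry-free deciding theorem `Summit.Langlands.Langlands.Theses.SplitPrimeExitCarving.closes`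
(two pointwise excluded middles on the prime type of `p` in the imaginary quadratic `F`: split ∣ ramified ∣ inert).  Nothing here proves
`Langlands` (nor EXIT): the assembly records only that the three cell items of the route, taken together, imply the host crux by name.
-/

set_option linter.dupNamespace false -- project-wide option (lakefile weak.linter.dupNamespace); `Summit.Langlands.Langlands` is the mandated namespace

namespace Summit.Langlands.Langlands.Theorems

/-- **Assembly of route SplitPrimeExitCarving** (stmt-Langlands-27474): `SPLIT → RAM → INERT → SkinnerWilesDefectOne.ProModularOrdinaryClassical`.
Proof: unfold `Assembly` and apply the route's deciding theorem `Theses.SplitPrimeExitCarving.closes`. -/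
theorem splitPrimeExitCarving_assembly_proof :
    Summit.Langlands.Langlands.Theses.SplitPrimeExitCarving.Assembly := by
  unfold Summit.Langlands.Langlands.Theses.SplitPrimeExitCarving.Assembly
  exact Summit.Langlands.Langlands.Theses.SplitPrimeExitCarving.closes

end Summit.Langlands.Langlands.Theorems
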